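import Summits.NavierStokesRegularity.NavierStokesRegularity.Theses.FilamentSkeletonRss
import HarnessLib.Audit

/-!
# Line `kelvin_gate` (typing v4, skeleton of record from 2026-08-28 per director-ns dss_37) for the crux `FilamentSkeletonRss.TransverseReductionRJ` (stmt-NavierStokesRegularity-21221)

v4 (prover ns-filament-21221-p1 g5, 2026-08-28; reshape APPROVED by director-ns dss_37 after the tenure planner's objection
window, registered by this item-named seat with `ledger crux write … Lines/kelvin_gate.lean` + `ledger skeleton check`).  ONLY
CHANGE w.r.t. v3 (sha16 c9f003954f208bf6, registered 2026-08-28T01:25Z, commits acffea9099e6 / e58e8a42bf00; its S2 record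
`stub_kelvinGate : PolynomialKelvinGate` is SUPERSEDED, not refuted): the quantifier PREFIXES of S2 and S3 and the two lines
of `TransverseReductionRJ_of` that thread them —
* S2 `EventualKelvinGate` (was `PolynomialKelvinGate`): `∀ Cs, ∃ κ C₂, ∃ k₀, ∀ k, k₀ ≤ k → 1 ≤ k → ∀ Cr, ∃ Γ₁, …` — the gate is
  demanded only around base families dressed to an order `k ≥ k₀` of the GATE'S choosing (after `κ, C₂`);
* S3 `NonlinearClosingFrom` (was `NonlinearClosing`): `∀ Cs κ C₂, ∀ k₀, ∃ k, k₀ ≤ k ∧ 1 ≤ k ∧ ∀ Cr, ∃ Γ₁, …` — the closing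
  may be asked to use any sufficiently high order (its proof takes `k = max(k₀, ⌊2κ⌋ + 1)` anyway).
WHY (Theorems/FilamentSkeletonRssKelvinGateOrderOne.lean, p606241): with the v3 prefix `∃ κ C₂, ∀ k ≥ 1, ∀ Cr` the stub is
EQUIVALENT to its `k = 1` restriction (`polynomialKelvinGate_iff_order_one`), i.e. it demands ONE pair of gate constants
around EVERY base family whose residual is merely `≤ Cr·Γ⁻¹`, `Cr` arbitrary; if (as the MODEL falsifier of record
suggests, κ_model ≈ 1) the mode-projected linearisation around the intended base has polynomially soft directions with
exponent `κ* > 1/2`, generic tuning of the base along `N + 1` such directions by amplitudes `~Γ^{-κ*}` stays inside that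
class and produces an admissible base whose mode-extended linearisation is NOT onto — no gate at all there
(`GateSpec.one_le_of_approxCokernel`, ε = 0).  With the v4 prefix the admissible tuning amplitude at order `k ≥ k₀ > 2κ`
is `≤ Cr Γ^{κ−k} ≪ Γ^{−κ}` and the mechanism is void, while `GateSpec.perturb_core` (p606737) transfers one gate to every
base X-close within `1/(8 C₂ Γ^κ)`.  S1, S4, `BaseSpec`, `GateSpec`, `AlmostAdmissibleJ` and every landed helper are
UNCHANGED; the J-clause question on `GateSpec` (3)/(4) (typer g30, dss_23) is orthogonal to this prefix change.

HONEST FRAMING.  This is bookkeeping for a HYPOTHETICAL filament-type rotating-self-similar (RSS) blow-up route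
(`route-NavierStokesRegularity-FilamentSkeletonRss`, refutation side: `closes … : ¬ NavierStokesRegularity`).  Nothing in
this file moves Navier–Stokes regularity; the four stubs below are OPEN and at least one of them (S2) is expected to be as
hard as anything on the route.  v3 drafted by the route's tenure planner (ns-filament-repair-plan g4, 2026-08-27) and registered
by seat ns-filament-21221-p1 g0 (2026-08-28T01:25Z); v4 = v3 with the S2/S3 prefixes reshaped (this header, §3, §4).

THE CRUX (verbatim cut in §1, certified by `transverseReductionRJ_iff := Iff.rfl`): for every box of filament skeleta
satisfying clauses 0–13J there is, for `Γ ≥ Γ₁`, a continuous-in-`p` family of smooth divergence-free profiles `U_p ≠ 0`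
solving the rotating Leray profile equation with rate `α_p` EXACTLY MODULO THE `N` ACCRETION MODES
`E_(α_p)(U_p) + ∇P_p = Σ_j B_pj D_pj`, with `|y|⁻¹` decay, bounded pressure, and `η√Γ`-closeness to the skeleton field in
the waist window off the tubes.

THE LINE (idea `kelvin_gate`, v3 = "polynomial gate + all-orders dressing"; supersedes the fixed-exponent typing of the
g3 line card, whose bookkeeping `σ + 2κ + ν < 0` cannot close because the slow tube-wise sector of the linearisation
inverts only at polynomial cost in `Γ` and fast–fast→slow quadratic interactions feed it):
* S1 `DressedSkeletonAllOrders` — matched-asymptotics DRESSING of the skeleton to any order `k`: a smooth base family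
  `(U⁰_p, P⁰_p, b⁰_p)` of polynomial size whose residual modulo accretion modes is `≤ Cr(k)·Γ^(−k)` in the weighted `C¹`
  scale, non-degenerate, window-close, locally continuous in `p` (spec `BaseSpec`).
* S2 `EventualKelvinGate` (v3: `PolynomialKelvinGate`; KILL-FIRST, hardest) — around every such base family (v4: of
  sufficiently high dressing order `k ≥ k₀`) the linearised profile operator
  `𝓛_(α_p,U⁰_p) + ∇` has a RIGHT INVERSE MODULO span{D_pj} (the "Kelvin gate"): linear, with polynomial bound `C₂Γ^κ`
  from the weighted `C¹` forcing scale to the weighted `C²` velocity scale, tight, locally continuous in `p`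
  (spec `GateSpec`).  `κ, C₂` depend on the box constants and the size constant `Cs` only.  This is where the physics
  sits: uniform-in-`Γ` control of the fast Kelvin-wave sector (dispersive/pseudospectral smoothing of the columnar
  vortex, Gallay–Maekawa / Gallay–Smets / Li–Wei–Zhang type) and transversality of the slow sector to the accretion
  modes INCLUDING the `e₃`-rotation cokernel direction (see the line card §Rate: the rate `α_p` is pinned by the crux, so
  the gate must absorb the rotation obstruction into span{D_pj}; if it cannot, S2 is false and the crux wants an R-β retype
  with a free rate `α'_p`).
* S3 `NonlinearClosingFrom` (v3: `NonlinearClosing`) — with `k > 2κ` (v4: and `k ≥ k₀`) the map `W ↦ 𝓚_p(−r_p − DW[W])` is a uniform contraction on an X-ball of radius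
  `2C₂Cr·Γ^(κ−k)`; its fixed point gives `U_p = U⁰_p + W_p` etc. satisfying the crux's conclusion with `C²/C¹` regularity
  (`AlmostAdmissibleJ`), continuity of `B_p` coming from tightness + local continuity (a small lemma recorded in the card).
* S4 `EllipticSmoothing` — interior regularity for the forced steady profile (Stokes-type) system upgrades `C²/C¹` to `C^∞`.
* `TransverseReductionRJ_of : S1 → S2 → S3 → S4 → TransverseReductionRJ` is PROVED below (pure logic: choose
  `Cs → (κ, C₂) → k → Cr → Γ₁ = max of three thresholds`), and `transverseReductionRJ_from_line` exhibits the crux from the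
  four `stub_*` so the audit lists exactly the sorries the line rests on.

`lean check`: rc 0, errors 0, sorries = 4 (only `stub_*`); `TransverseReductionRJ_of` = proof conditional on exactly S1–S4,
target `…Theses.FilamentSkeletonRss.TransverseReductionRJ` by name.  Guards (dss_37 (2)): (a) `EventualKelvinGate` → (with S1,
S3′, S4) → the crux BY NAME, the crux text itself untouched; (b) S3′ `NonlinearClosingFrom` keeps typer g30's Picard/Static
helpers applicable verbatim (same body, any k ≥ max(k₀, ⌊2κ⌋+1)); (c) stub S4 `stub_ellipticSmoothing : EllipticSmoothing`
LANDED (p599682) and S1 are unchanged.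
-/

noncomputable section

namespace Summit.NavierStokesRegularity.NavierStokesRegularity.Cruxes.TransverseReductionRJ.KelvinGate

open scoped BigOperators Topology Manifold Classical MeasureTheory ProbabilityTheory Matrix InnerProductSpace ComplexConjugate ContinuousMap ENNReal
open Filter Set Function TopologicalSpace MeasureTheory
open Literature.NS
open Literature.Analysis.FluidPDE
open Summit.NavierStokesRegularity.NavierStokesRegularity.Theses.FilamentSkeletonRss


/-! ## 1. The crux, cut at its arrows (texts VERBATIM from the route decl `TransverseReductionRJ`, l.403 of the route file) -/

/-- Defining hypothesis 1 of `TransverseReductionRJ`: `u` is the regularised Biot–Savart field of a filament family. -/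
def DefU (N : ℕ) (Γ : ℝ) (γ : (Fin N → ℝ) → Fin N → ℝ) (u : (Fin N → ℝ) → (Fin N → ℝ → EuclideanSpace ℝ (Fin 3)) → EuclideanSpace ℝ (Fin 3) → EuclideanSpace ℝ (Fin 3)) : Prop :=
  ∀ p Z y, u p Z y = ∑ k, (Γ*γ p k/(4*Real.pi))•∫ σ:ℝ, ((‖y-Z k σ‖^2+1)^(3/2:ℝ))⁻¹•cross (deriv (Z k) σ) (y-Z k σ)

/-- Defining hypothesis 2: the frame field `v = u(X) + ½y − α e₃ × y`. -/
def DefV (N : ℕ) (α : (Fin N → ℝ) → ℝ) (X : (Fin N → ℝ) → Fin N → ℝ → EuclideanSpace ℝ (Fin 3)) (u : (Fin N → ℝ) → (Fin N → ℝ → EuclideanSpace ℝ (Fin 3)) → EuclideanSpace ℝ (Fin 3) → EuclideanSpace ℝ (Fin 3)) (v : (Fin N → ℝ) → EuclideanSpace ℝ (Fin 3) → EuclideanSpace ℝ (Fin 3)) : Prop :=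
  ∀ p y, v p y = u p (X p) y+(1/2:ℝ)•y-α p•cross (EuclideanSpace.single 2 1) y

/-- Defining hypothesis 3: the waist gradients `A_pj = Dv_p(X_pj(c_pj))`. -/
def DefA (N : ℕ) (X : (Fin N → ℝ) → Fin N → ℝ → EuclideanSpace ℝ (Fin 3)) (c : (Fin N → ℝ) → Fin N → ℝ) (v : (Fin N → ℝ) → EuclideanSpace ℝ (Fin 3) → EuclideanSpace ℝ (Fin 3)) (A : (Fin N → ℝ) → Fin N → (EuclideanSpace ℝ (Fin 3) →L[ℝ] EuclideanSpace ℝ (Fin 3))) : Prop :=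
  ∀ p j, A p j = fderiv ℝ (v p) (X p j (c p j))

/-- Defining hypothesis 4: the normal-tangency residual `T`. -/
def DefT (N : ℕ) (α : (Fin N → ℝ) → ℝ) (u : (Fin N → ℝ) → (Fin N → ℝ → EuclideanSpace ℝ (Fin 3)) → EuclideanSpace ℝ (Fin 3) → EuclideanSpace ℝ (Fin 3)) (T : (Fin N → ℝ) → (Fin N → ℝ → EuclideanSpace ℝ (Fin 3)) → Fin N → ℝ → EuclideanSpace ℝ (Fin 3)) : Prop :=
  ∀ p Z j τ, T p Z j τ = (u p Z (Z j τ)+(1/2:ℝ)•Z j τ-α p•cross (EuclideanSpace.single 2 1) (Z j τ))-(⟪u p Z (Z j τ)+(1/2:ℝ)•Z j τ-α p•cross (EuclideanSpace.single 2 1) (Z j τ), deriv (Z j) τ⟫_ℝ/‖deriv (Z j) τ‖^2)•deriv (Z j) τ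

/-- Defining hypothesis 5: the accretion modes `D_pj`. -/
def DefD (N : ℕ) (X : (Fin N → ℝ) → Fin N → ℝ → EuclideanSpace ℝ (Fin 3)) (c : (Fin N → ℝ) → Fin N → ℝ) (D : (Fin N → ℝ) → Fin N → EuclideanSpace ℝ (Fin 3) → EuclideanSpace ℝ (Fin 3)) : Prop :=
  ∀ p j y, D p j y = (Real.exp (-(⟪y-X p j (c p j), deriv (X p j) (c p j)⟫_ℝ)^2)*((1-Real.exp (-(‖y-X p j (c p j)‖^2-⟪y-X p j (c p j), deriv (X p j) (c p j)⟫_ℝ^2)))/(‖y-X p j (c p j)‖^2-⟪y-X p j (c p j), deriv (X p j) (c p j)⟫_ℝ^2)))•cross (deriv (X p j) (c p j)) (y-X p j (c p j))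

/-- The K1‴ ball-box clauses 0–13J of `TransverseReductionRJ` (= those of `SelectionBoxRJ`), VERBATIM. -/
def BoxClausesJ (N : ℕ) (Γ δ ρ K Λ a b cnd Rw Rb cg θ₀ : ℝ) (γ : (Fin N → ℝ) → Fin N → ℝ) (α : (Fin N → ℝ) → ℝ) (X : (Fin N → ℝ) → Fin N → ℝ → EuclideanSpace ℝ (Fin 3)) (w : (Fin N → ℝ) → Fin N → ℝ → ℝ) (c : (Fin N → ℝ) → Fin N → ℝ) (m : (Fin N → ℝ) → Fin N → EuclideanSpace ℝ (Fin 3)) (n : (Fin N → ℝ) → Fin N → EuclideanSpace ℝ (Fin 3)) (v : (Fin N → ℝ) → EuclideanSpace ℝ (Fin 3) → EuclideanSpace ℝ (Fin 3)) (A : (Fin N → ℝ) → Fin N → (EuclideanSpace ℝ (Fin 3) →L[ℝ] EuclideanSpace ℝ (Fin 3))) (T : (Fin N → ℝ) → (Fin N → ℝ → EuclideanSpace ℝ (Fin 3)) → Fin N → ℝ → EuclideanSpace ℝ (Fin 3)) : Prop :=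
  (∀ j, ContinuousOn (fun q:(Fin N→ℝ) × ℝ => (α q.1, γ q.1 j, X q.1 j q.2, w q.1 j q.2)) ({p:Fin N → ℝ | ∀ i, p i ∈ Icc 0 1} ×ˢ univ))∧(∀ p:Fin N → ℝ, (∀ i, p i ∈ Icc 0 1) → α p ≠ 0 ∧ (∀ j, γ p j ≠ 0)∧(∀ j, ContDiff ℝ 2 (X p j) ∧ Differentiable ℝ (w p j)∧(∀ τ, ‖deriv (X p j) τ‖ = 1)∧(∀ τ, ‖iteratedDeriv 2 (X p j) τ‖*√Γ≤K) ∧ Tendsto (fun τ => ‖X p j τ‖) (cocompact ℝ) atTop)∧(∀ j k, j ≠ k → ∀ τ σ, ρ*√Γ≤‖X p j τ-X p k σ‖)∧(∀ j τ σ, ρ*√Γ≤|τ-σ| → cg*ρ*√Γ≤‖X p j τ-X p j σ‖)∧(∀ j τ, cg*|τ-c p j|≤Rw*√Γ+‖X p j τ‖)∧(∀ j τ, w p j τ = ⟪v p (X p j τ), deriv (X p j) τ⟫_ℝ)∧(∀ j τ, ‖X p j τ‖≤Rb*√(Γ*Real.log Γ) → v p (X p j τ) = w p j τ•deriv (X p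 j) τ)∧(∀ j, ‖X p j (c p j)‖≤Rw*√Γ)∧(∀ j, |⟪deriv (X p j) (c p j), EuclideanSpace.single 2 1⟫_ℝ|≤1-θ₀)∧(θ₀≤|α p| ∧ |α p|≤θ₀⁻¹ ∧ ∀ j, θ₀≤|γ p j| ∧ |γ p j|≤θ₀⁻¹)∧(∀ j, w p j (c p j) = 0 ∧ (∀ τ, w p j τ = 0 → τ = c p j) ∧ 3/2+δ≤deriv (w p j) (c p j) ∧ deriv (w p j) (c p j)≤Λ)∧(∀ j, Orthonormal ℝ ![deriv (X p j) (c p j), m p j, n p j] ∧ ⟪A p j (m p j), m p j⟫_ℝ+⟪A p j (n p j), n p j⟫_ℝ < 0 ∧ ⟪A p j (n p j), m p j⟫_ℝ * ⟪A p j (m p j), n p j⟫_ℝ < ⟪A p j (m p j), m p j⟫_ℝ * ⟪A p j (n p j), n p j⟫_ℝ)∧(∀ Y:Fin N → ℝ → EuclideanSpace ℝ (Fin 3), (∀ j, ContDiff ℝ 2 (Y j))→(∀ j τ, ⟪Y j τ, deriv (X p j) τ⟫_ℝ = 0) → (∀ j τ, Rb*√(Γ*Real.log Γ) < ‖X p j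 τ‖ → Y j τ = 0) → ∑ j, ⟪Y j (c p j), cross (EuclideanSpace.single 2 1) (X p j (c p j))⟫_ℝ = 0 → (∀ j τ, ‖Y j τ‖+‖deriv (Y j) τ‖+‖iteratedDeriv 2 (Y j) τ‖≤(1+|τ-c p j|)^b) → ∀ L:ℝ, (∀ j τ, ‖deriv (fun s:ℝ => T p (fun k σ => X p k σ+s•Y k σ) j τ) 0‖≤L*(1+|τ-c p j|)^a) → ∀ j τ, ‖Y j τ‖≤cnd*L*(1+|τ-c p j|)^b))

/-- The conclusion block of `TransverseReductionRJ`: an ADMISSIBLE reduced family `(C₀, M, U, P, B)`, VERBATIM. -/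
def AdmissibleJ (N : ℕ) (Γ ρ η Rw : ℝ) (α : (Fin N → ℝ) → ℝ) (X : (Fin N → ℝ) → Fin N → ℝ → EuclideanSpace ℝ (Fin 3)) (u : (Fin N → ℝ) → (Fin N → ℝ → EuclideanSpace ℝ (Fin 3)) → EuclideanSpace ℝ (Fin 3) → EuclideanSpace ℝ (Fin 3)) (D : (Fin N → ℝ) → Fin N → EuclideanSpace ℝ (Fin 3) → EuclideanSpace ℝ (Fin 3)) (C₀ M : ℝ) (U : (Fin N → ℝ) → EuclideanSpace ℝ (Fin 3) → EuclideanSpace ℝ (Fin 3)) (P : (Fin N → ℝ) → EuclideanSpace ℝ (Fin 3) → ℝ) (B : (Fin N → ℝ) → Fin N → ℝ) : Prop :=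
  ContinuousOn B {p:Fin N → ℝ | ∀ i, p i ∈ Icc 0 1} ∧ ∀ p:Fin N → ℝ, (∀ i, p i ∈ Icc 0 1) → U p ≠ 0 ∧ ContDiff ℝ (⊤:ℕ∞) (U p) ∧ ContDiff ℝ (⊤:ℕ∞) (P p) ∧ VectorCalculus.IsDivFree (U p)∧(∀ y, α p•(cross (EuclideanSpace.single 2 1) (U p y)-fderiv ℝ (U p) y (cross (EuclideanSpace.single 2 1) y))+(1/2:ℝ)•U p y+(1/2:ℝ)•fderiv ℝ (U p) y y-(Laplacian.laplacian (U p)) y+fderiv ℝ (U p) y (U p y)+gradient (P p) y = ∑ j, B p j•D p j y)∧(∀ y, ‖U p y‖≤C₀/(1+‖y‖))∧(∀ y, |P p y|≤M)∧(∀ y, ‖y‖≤Rw*√Γ → (∀ j τ, ρ*√Γ/4≤‖y-X p j τ‖) → ‖U p y-u p (X p) y‖≤η*√Γ)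

/-- Sanity (definitional unfolding only): the crux IS
`∀ consts, pos → ∃ Γ₁, ∀ Γ ≥ Γ₁, ∀ data, DefU → DefV → DefA → DefT → DefD → BoxClausesJ → ∃ family, AdmissibleJ`. [folklore] -/
theorem transverseReductionRJ_iff :
    TransverseReductionRJ ↔ (∀ (N:ℕ) (δ ρ K Λ a b cnd η Rw Rb cg θ₀:ℝ), 0 < N → 0 < δ → 0 < ρ → 0 ≤ a → 0 < η → 0 < Rw → 0 < Rb → 0 < cg → 0 < θ₀ → ∃ Γ₁:ℝ, ∀ Γ:ℝ, Γ₁≤Γ → ∀ (γ:(Fin N→ℝ) → Fin N → ℝ) (α:(Fin N→ℝ) → ℝ) (X:(Fin N→ℝ) → Fin N → ℝ → EuclideanSpace ℝ (Fin 3)) (w:(Fin N→ℝ) → Fin N → ℝ → ℝ) (c:(Fin N→ℝ) → Fin N → ℝ) (m n:(Fin N→ℝ) → Fin N → EuclideanSpace ℝ (Fin 3)) (u:(Fin N→ℝ)→(Fin N → ℝ → EuclideanSpace ℝ (Fin 3)) → EuclideanSpace ℝ (Fin 3) → EuclideanSpace ℝ (Fin 3)) (v:(Fin N→ℝ) → EuclideanSpace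 ℝ (Fin 3) → EuclideanSpace ℝ (Fin 3)) (A:(Fin N→ℝ) → Fin N → (EuclideanSpace ℝ (Fin 3) →L[ℝ] EuclideanSpace ℝ (Fin 3))) (T:(Fin N→ℝ)→(Fin N → ℝ → EuclideanSpace ℝ (Fin 3)) → Fin N → ℝ → EuclideanSpace ℝ (Fin 3)) (D:(Fin N→ℝ) → Fin N → EuclideanSpace ℝ (Fin 3) → EuclideanSpace ℝ (Fin 3)), DefU N Γ γ u → DefV N α X u v → DefA N X c v A → DefT N α u T → DefD N X c D → BoxClausesJ N Γ δ ρ K Λ a b cnd Rw Rb cg θ₀ γ α X w c m n v A T → ∃ (C₀ M:ℝ) (U:(Fin N→ℝ) → EuclideanSpace ℝ (Fin 3) → EuclideanSpace ℝ (Fin 3)) (P:(Fin N→ℝ) → EuclideanSpace ℝ (Fin 3) → ℝ) (B:(Fin N→ℝ) → Fin N → ℝ), AdmissibleJ N Γ ρ η Rw α X u D C₀ M U P B) :=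
  Iff.rfl


/-! ## 2. Analytic vocabulary of the line (the only NEW definitions; §1 is the crux verbatim)

Units are the crux's (absolute).  Tubes carry circulation `Γγ_pj` with `O(1)` cores, so a dressed skeleton has velocity
`O(Γ)` at the cores and frame velocities `O(√Γ)` at the window scale `|y| ~ √Γ`; every constant below may be POLYNOMIAL
in `Γ`.  The line is organised so that only polynomial losses occur (stub S2) and the dressing (stub S1) pays for them to
any order (stub S3 picks the order). -/

/-- Pointwise rotating-Leray PROFILE OPERATOR (velocity part; the pressure gradient is added separately):
`E_α(U)(y) = α (e₃ × U(y) − DU(y)[e₃ × y]) + ½ U(y) + ½ DU(y)[y] − ΔU(y) + DU(y)[U(y)]` — the left side of the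
crux's profile equation, in the crux's own pointwise vocabulary (`fderiv`, `Laplacian.laplacian`, `cross`, `gradient`). -/
def lerayOp (α : ℝ) (U : EuclideanSpace ℝ (Fin 3) → EuclideanSpace ℝ (Fin 3)) (y : EuclideanSpace ℝ (Fin 3)) : EuclideanSpace ℝ (Fin 3) :=
  α • (cross (EuclideanSpace.single 2 1) (U y) - fderiv ℝ U y (cross (EuclideanSpace.single 2 1) y)) + (1/2:ℝ) • U y + (1/2:ℝ) • fderiv ℝ U y y - (Laplacian.laplacian U) y + fderiv ℝ U y (U y)

/-- Its LINEARISATION at a base field `U⁰`: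
`𝓛_(α,U⁰) W (y) = α (e₃ × W − DW[e₃ × y]) + ½ W + ½ DW[y] − ΔW + DW[U⁰] + DU⁰[W]`
(so that `E_α(U⁰ + W) = E_α(U⁰) + 𝓛 W + DW[W]` pointwise for differentiable fields). -/
def lerayLin (α : ℝ) (U0 W : EuclideanSpace ℝ (Fin 3) → EuclideanSpace ℝ (Fin 3)) (y : EuclideanSpace ℝ (Fin 3)) : EuclideanSpace ℝ (Fin 3) :=
  α • (cross (EuclideanSpace.single 2 1) (W y) - fderiv ℝ W y (cross (EuclideanSpace.single 2 1) y)) + (1/2:ℝ) • W y + (1/2:ℝ) • fderiv ℝ W y y - (Laplacian.laplacian W) y + fderiv ℝ W y (U0 y) + fderiv ℝ U0 y (W y)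

/-- X-scale (velocity-type fields): `W ∈ C²` and `⟨y⟩·|W|, ⟨y⟩·|DW|, ⟨y⟩·|D²W| ≤ R` pointwise, `⟨y⟩ = 1 + |y|`
(`|y|⁻¹` is the scaling-neutral tail of `½ + ½ y·∇` and the decay class of the crux's conclusion).  Sup-type sizes are
pointwise inequalities with an explicit constant: no `⨆`, no junk value. -/
def XBound (W : EuclideanSpace ℝ (Fin 3) → EuclideanSpace ℝ (Fin 3)) (R : ℝ) : Prop :=
  ContDiff ℝ 2 W ∧ ∀ y, (1 + ‖y‖) * ‖W y‖ ≤ R ∧ (1 + ‖y‖) * ‖fderiv ℝ W y‖ ≤ R ∧ (1 + ‖y‖) * ‖iteratedFDeriv ℝ 2 W y‖ ≤ R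

/-- Y-scale (forcing-type fields): `F ∈ C¹` and `⟨y⟩²·|F|, ⟨y⟩²·|DF| ≤ R` pointwise (one derivative, so that `C²`
solutions are the natural output of an elliptic right inverse; `⟨y⟩⁻²` is the decay of `DW[W]` for `W` in the X-scale). -/
def YBound (F : EuclideanSpace ℝ (Fin 3) → EuclideanSpace ℝ (Fin 3)) (R : ℝ) : Prop :=
  ContDiff ℝ 1 F ∧ ∀ y, (1 + ‖y‖) ^ 2 * ‖F y‖ ≤ R ∧ (1 + ‖y‖) ^ 2 * ‖fderiv ℝ F y‖ ≤ R

/-- Local `C¹` closeness on the ball `|y| ≤ L` — the topology in which families may depend continuously on the box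
parameter `p` (clause 0 gives joint continuity of the skeleton in `(p, τ)` only: far tails move, so GLOBAL weighted
continuity in `p` is not available and is never asked for). -/
def LocClose (W W' : EuclideanSpace ℝ (Fin 3) → EuclideanSpace ℝ (Fin 3)) (L ε : ℝ) : Prop :=
  ∀ y, ‖y‖ ≤ L → ‖W y - W' y‖ ≤ ε ∧ ‖fderiv ℝ W y - fderiv ℝ W' y‖ ≤ ε

/-- Residual of a candidate base family MODULO the accretion modes:
`r_p(y) = E_(α_p)(U⁰_p)(y) + ∇P⁰_p(y) − Σ_j b⁰_pj · D_pj(y)`. -/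
def baseRes {N : ℕ} (α : (Fin N → ℝ) → ℝ) (D : (Fin N → ℝ) → Fin N → EuclideanSpace ℝ (Fin 3) → EuclideanSpace ℝ (Fin 3)) (U0 : (Fin N → ℝ) → EuclideanSpace ℝ (Fin 3) → EuclideanSpace ℝ (Fin 3)) (P0 : (Fin N → ℝ) → EuclideanSpace ℝ (Fin 3) → ℝ) (b0 : (Fin N → ℝ) → Fin N → ℝ) (p : Fin N → ℝ) (y : EuclideanSpace ℝ (Fin 3)) : EuclideanSpace ℝ (Fin 3) :=
  lerayOp (α p) (U0 p) y + gradient (P0 p) y - ∑ j, b0 p j • D p j y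

/-- **D2 · DRESSED BASE FAMILY of order `k`** (the spec stub S1 produces and stubs S2, S3 consume).
`p ↦ (U⁰_p, P⁰_p, b⁰_p)` on the cube: smooth, divergence-free, of polynomial size `Cs·Γ⁴` in the X-scale (pressure and
multipliers bounded likewise), NON-DEGENERATE (`|U⁰_p(y₀)| ≥ 1` somewhere), `η√Γ/2`-close to the skeleton field `u_p(X_p)`
off the `ρ√Γ/4`-tubes inside the waist ball (half the crux's tolerance), residual modulo accretion modes of Y-size
`≤ Cr·Γ^(−k)`, multipliers continuous on the cube, and `U⁰_p`, `r_p` locally continuous in `p`. -/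
def BaseSpec (N : ℕ) (Γ ρ η Rw : ℝ) (k : ℕ) (Cs Cr : ℝ) (α : (Fin N → ℝ) → ℝ) (X : (Fin N → ℝ) → Fin N → ℝ → EuclideanSpace ℝ (Fin 3)) (u : (Fin N → ℝ) → (Fin N → ℝ → EuclideanSpace ℝ (Fin 3)) → EuclideanSpace ℝ (Fin 3) → EuclideanSpace ℝ (Fin 3)) (D : (Fin N → ℝ) → Fin N → EuclideanSpace ℝ (Fin 3) → EuclideanSpace ℝ (Fin 3)) (U0 : (Fin N → ℝ) → EuclideanSpace ℝ (Fin 3) → EuclideanSpace ℝ (Fin 3)) (P0 : (Fin N → ℝ) → EuclideanSpace ℝ (Fin 3) → ℝ) (b0 : (Fin N → ℝ) → Fin N → ℝ) : Prop :=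
  ContinuousOn b0 {p : Fin N → ℝ | ∀ i, p i ∈ Icc 0 1} ∧
  ∀ p : Fin N → ℝ, (∀ i, p i ∈ Icc 0 1) →
    ContDiff ℝ (⊤:ℕ∞) (U0 p) ∧ ContDiff ℝ (⊤:ℕ∞) (P0 p) ∧ VectorCalculus.IsDivFree (U0 p) ∧
    XBound (U0 p) (Cs * Γ ^ 4) ∧ (∀ y, |P0 p y| ≤ Cs * Γ ^ 4) ∧ (∀ j, |b0 p j| ≤ Cs * Γ ^ 4) ∧
    (∃ y₀, 1 ≤ ‖U0 p y₀‖) ∧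
    (∀ y, ‖y‖ ≤ Rw * √Γ → (∀ j τ, ρ * √Γ / 4 ≤ ‖y - X p j τ‖) → ‖U0 p y - u p (X p) y‖ ≤ η * √Γ / 2) ∧
    YBound (baseRes α D U0 P0 b0 p) (Cr * Γ ^ (-(k:ℝ))) ∧
    (∀ L ε : ℝ, 0 < ε → ∃ δ' : ℝ, 0 < δ' ∧ ∀ q : Fin N → ℝ, (∀ i, q i ∈ Icc 0 1) → dist q p < δ' →
        LocClose (U0 q) (U0 p) L ε ∧ ∀ y, ‖y‖ ≤ L → ‖baseRes α D U0 P0 b0 q y - baseRes α D U0 P0 b0 p y‖ ≤ ε)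

/-- **D3 · POLYNOMIAL KELVIN GATE** (the spec stub S2 produces and stub S3 consumes): a RIGHT INVERSE
`F ↦ (W, Q, b) = (𝓚_p F, 𝓠_p F, 𝓑_p F)` of the linearised profile operator MODULO THE ACCRETION MODES,
`𝓛_(α_p, U⁰_p) W + ∇Q = F + Σ_j b_j D_pj`, `div W = 0`, with the POLYNOMIAL bound
`X-size(W), |Q|, |b| ≤ C₂ Γ^κ · Y-size(F)`; linear on Y-bounded data; TIGHT (uniformly Y-bounded forcings that are small
on a large ball give locally small response and small multipliers); locally continuous in `p` for fixed data.  The `N`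
accretion modes are the ONLY extra forcing directions, exactly as in the crux's conclusion (no rotation-generator
direction; see the line card §Rate for why, and what the gate therefore asserts about the rotation cokernel). -/
def GateSpec (N : ℕ) (Γ κ C₂ : ℝ) (α : (Fin N → ℝ) → ℝ) (D : (Fin N → ℝ) → Fin N → EuclideanSpace ℝ (Fin 3) → EuclideanSpace ℝ (Fin 3)) (U0 : (Fin N → ℝ) → EuclideanSpace ℝ (Fin 3) → EuclideanSpace ℝ (Fin 3)) (𝓚 : (Fin N → ℝ) → (EuclideanSpace ℝ (Fin 3) → EuclideanSpace ℝ (Fin 3)) → EuclideanSpace ℝ (Fin 3) → EuclideanSpace ℝ (Fin 3)) (𝓠 : (Fin N → ℝ) → (EuclideanSpace ℝ (Fin 3) → EuclideanSpace ℝ (Fin 3)) → EuclideanSpace ℝ (Fin 3) → ℝ) (𝓑 : (Fin N → ℝ) → (EuclideanSpace ℝ (Fin 3) → EuclideanSpace ℝ (Fin 3)) → Fin N → ℝ) : Prop :=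
  ∀ p : Fin N → ℝ, (∀ i, p i ∈ Icc 0 1) →
    (∀ (F : EuclideanSpace ℝ (Fin 3) → EuclideanSpace ℝ (Fin 3)) (R : ℝ), YBound F R →
        XBound (𝓚 p F) (C₂ * Γ ^ κ * R) ∧ ContDiff ℝ 1 (𝓠 p F) ∧ (∀ y, |𝓠 p F y| ≤ C₂ * Γ ^ κ * R) ∧ (∀ j, |𝓑 p F j| ≤ C₂ * Γ ^ κ * R) ∧
        VectorCalculus.IsDivFree (𝓚 p F) ∧
        ∀ y, lerayLin (α p) (U0 p) (𝓚 p F) y + gradient (𝓠 p F) y = F y + ∑ j, 𝓑 p F j • D p j y) ∧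
    (∀ (F G : EuclideanSpace ℝ (Fin 3) → EuclideanSpace ℝ (Fin 3)) (s : ℝ), (∃ R, YBound F R) → (∃ R, YBound G R) →
        (𝓚 p (fun y => F y + s • G y) = fun y => 𝓚 p F y + s • 𝓚 p G y) ∧ (𝓑 p (fun y => F y + s • G y) = fun j => 𝓑 p F j + s * 𝓑 p G j)) ∧
    (∀ R L ε : ℝ, 0 < ε → ∃ L' δ₀ : ℝ, 0 < δ₀ ∧ ∀ F : EuclideanSpace ℝ (Fin 3) → EuclideanSpace ℝ (Fin 3), YBound F R → (∀ y, ‖y‖ ≤ L' → ‖F y‖ ≤ δ₀) →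
        (∀ y, ‖y‖ ≤ L → ‖𝓚 p F y‖ ≤ ε ∧ ‖fderiv ℝ (𝓚 p F) y‖ ≤ ε) ∧ ∀ j, |𝓑 p F j| ≤ ε) ∧
    (∀ (F : EuclideanSpace ℝ (Fin 3) → EuclideanSpace ℝ (Fin 3)) (R L ε : ℝ), YBound F R → 0 < ε → ∃ δ' : ℝ, 0 < δ' ∧ ∀ q : Fin N → ℝ, (∀ i, q i ∈ Icc 0 1) → dist q p < δ' →
        LocClose (𝓚 q F) (𝓚 p F) L ε ∧ ∀ j, |𝓑 q F j - 𝓑 p F j| ≤ ε)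

/-- The crux's conclusion block with FINITE regularity (`U_p ∈ C²`, `P_p ∈ C¹`): what the fixed point of stub S3 delivers
before elliptic smoothing (stub S4); otherwise VERBATIM `AdmissibleJ`. -/
def AlmostAdmissibleJ (N : ℕ) (Γ ρ η Rw : ℝ) (α : (Fin N → ℝ) → ℝ) (X : (Fin N → ℝ) → Fin N → ℝ → EuclideanSpace ℝ (Fin 3)) (u : (Fin N → ℝ) → (Fin N → ℝ → EuclideanSpace ℝ (Fin 3)) → EuclideanSpace ℝ (Fin 3) → EuclideanSpace ℝ (Fin 3)) (D : (Fin N → ℝ) → Fin N → EuclideanSpace ℝ (Fin 3) → EuclideanSpace ℝ (Fin 3)) (C₀ M : ℝ) (U : (Fin N → ℝ) → EuclideanSpace ℝ (Fin 3) → EuclideanSpace ℝ (Fin 3)) (P : (Fin N → ℝ) → EuclideanSpace ℝ (Fin 3) → ℝ) (B : (Fin N → ℝ) → Fin N → ℝ) : Prop :=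
  ContinuousOn B {p:Fin N → ℝ | ∀ i, p i ∈ Icc 0 1} ∧ ∀ p:Fin N → ℝ, (∀ i, p i ∈ Icc 0 1) → U p ≠ 0 ∧ ContDiff ℝ 2 (U p) ∧ ContDiff ℝ 1 (P p) ∧ VectorCalculus.IsDivFree (U p)∧(∀ y, α p•(cross (EuclideanSpace.single 2 1) (U p y)-fderiv ℝ (U p) y (cross (EuclideanSpace.single 2 1) y))+(1/2:ℝ)•U p y+(1/2:ℝ)•fderiv ℝ (U p) y y-(Laplacian.laplacian (U p)) y+fderiv ℝ (U p) y (U p y)+gradient (P p) y = ∑ j, B p j•D p j y)∧(∀ y, ‖U p y‖≤C₀/(1+‖y‖))∧(∀ y, |P p y|≤M)∧(∀ y, ‖y‖≤Rw*√Γ → (∀ j τ, ρ*√Γ/4≤‖y-X p j τ‖) → ‖U p y-u p (X p) y‖≤η*√Γ)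

/-! ## 3. The four stub STATEMENTS (S1 dressing · S2 gate · S3 closing · S4 smoothing) -/

/-- Statement of stub S1 · `DressedSkeletonAllOrders` (size XL; classical-type matched asymptotics): for every order `k`
the box skeleton can be DRESSED into a base family of order `k` (spec `BaseSpec`), its size constant `Cs` uniform in `k`. -/
def DressedSkeletonAllOrders : Prop :=
  ∀ (N : ℕ) (δ ρ K Λ a b cnd η Rw Rb cg θ₀ : ℝ), 0 < N → 0 < δ → 0 < ρ → 0 ≤ a → 0 < η → 0 < Rw → 0 < Rb → 0 < cg → 0 < θ₀ →
    ∃ Cs : ℝ, ∀ k : ℕ, ∃ Cr Γ₁ : ℝ, ∀ Γ : ℝ, Γ₁ ≤ Γ → ∀ (γ : (Fin N → ℝ) → Fin N → ℝ) (α : (Fin N → ℝ) → ℝ) (X : (Fin N → ℝ) → Fin N → ℝ → EuclideanSpace ℝ (Fin 3)) (w : (Fin N → ℝ) → Fin N → ℝ → ℝ) (c : (Fin N → ℝ) → Fin N → ℝ) (m : (Fin N → ℝ) → Fin N → EuclideanSpace ℝ (Fin 3)) (n : (Fin N → ℝ) → Fin N → EuclideanSpace ℝ (Fin 3)) (u :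 (Fin N → ℝ) → (Fin N → ℝ → EuclideanSpace ℝ (Fin 3)) → EuclideanSpace ℝ (Fin 3) → EuclideanSpace ℝ (Fin 3)) (v : (Fin N → ℝ) → EuclideanSpace ℝ (Fin 3) → EuclideanSpace ℝ (Fin 3)) (A : (Fin N → ℝ) → Fin N → (EuclideanSpace ℝ (Fin 3) →L[ℝ] EuclideanSpace ℝ (Fin 3))) (T : (Fin N → ℝ) → (Fin N → ℝ → EuclideanSpace ℝ (Fin 3)) → Fin N → ℝ → EuclideanSpace ℝ (Fin 3)) (D : (Fin N → ℝ) → Fin N → EuclideanSpace ℝ (Fin 3) → EuclideanSpace ℝ (Fin 3)),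
      DefU N Γ γ u → DefV N α X u v → DefA N X c v A → DefT N α u T → DefD N X c D → BoxClausesJ N Γ δ ρ K Λ a b cnd Rw Rb cg θ₀ γ α X w c m n v A T →
      ∃ (U0 : (Fin N → ℝ) → EuclideanSpace ℝ (Fin 3) → EuclideanSpace ℝ (Fin 3)) (P0 : (Fin N → ℝ) → EuclideanSpace ℝ (Fin 3) → ℝ) (b0 : (Fin N → ℝ) → Fin N → ℝ), BaseSpec N Γ ρ η Rw k Cs Cr α X u D U0 P0 b0

/-- Statement of stub S2 · `EventualKelvinGate` (size XL; KILL-FIRST, HARDEST): around EVERY dressed base family of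
any SUFFICIENTLY HIGH order `k ≥ k₀` (the threshold `k₀` chosen together with the gate constants, after `Cs`) and size
`Cs` there is a polynomial Kelvin gate (spec `GateSpec`) with exponent `κ` and constant `C₂` depending on the box
constants and `Cs` only — not on `Γ`, `p`, the data, or `k`.  (v4: `∃ k₀` added; v3 `PolynomialKelvinGate` had `∀ k ≥ 1`
and was thereby equivalent to its `k = 1` restriction, `Theorems.KelvinGate.polynomialKelvinGate_iff_order_one`.) -/
def EventualKelvinGate : Prop :=
  ∀ (N : ℕ) (δ ρ K Λ a b cnd η Rw Rb cg θ₀ : ℝ), 0 < N → 0 < δ → 0 < ρ → 0 ≤ a → 0 < η → 0 < Rw → 0 < Rb → 0 < cg → 0 < θ₀ →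
    ∀ Cs : ℝ, ∃ κ C₂ : ℝ, ∃ k₀ : ℕ, ∀ k : ℕ, k₀ ≤ k → 1 ≤ k → ∀ Cr : ℝ, ∃ Γ₁ : ℝ, ∀ Γ : ℝ, Γ₁ ≤ Γ → ∀ (γ : (Fin N → ℝ) → Fin N → ℝ) (α : (Fin N → ℝ) → ℝ) (X : (Fin N → ℝ) → Fin N → ℝ → EuclideanSpace ℝ (Fin 3)) (w : (Fin N → ℝ) → Fin N → ℝ → ℝ) (c : (Fin N → ℝ) → Fin N → ℝ) (m : (Fin N → ℝ) → Fin N → EuclideanSpace ℝ (Fin 3)) (n : (Fin N → ℝ) → Fin N → EuclideanSpace ℝ (Fin 3)) (u : (Fin N → ℝ) → (Fin N → ℝ → EuclideanSpace ℝ (Fin 3)) → EuclideanSpace ℝ (Fin 3) → EuclideanSpace ℝ (Fin 3)) (v : (Fin N → ℝ) → EuclideanSpace ℝ (Fin 3) → EuclideanSpace ℝ (Fin 3)) (A : (Fin N → ℝ) → Fin N → (EuclideanSpace ℝ (Fin 3) →L[ℝ] EuclideanSpace ℝ (Fin 3))) (T : (Fin N → ℝ) → (Fin N → ℝ → EuclideanSpace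 ℝ (Fin 3)) → Fin N → ℝ → EuclideanSpace ℝ (Fin 3)) (D : (Fin N → ℝ) → Fin N → EuclideanSpace ℝ (Fin 3) → EuclideanSpace ℝ (Fin 3)),
      DefU N Γ γ u → DefV N α X u v → DefA N X c v A → DefT N α u T → DefD N X c D → BoxClausesJ N Γ δ ρ K Λ a b cnd Rw Rb cg θ₀ γ α X w c m n v A T →
      ∀ (U0 : (Fin N → ℝ) → EuclideanSpace ℝ (Fin 3) → EuclideanSpace ℝ (Fin 3)) (P0 : (Fin N → ℝ) → EuclideanSpace ℝ (Fin 3) → ℝ) (b0 : (Fin N → ℝ) → Fin N → ℝ), BaseSpec N Γ ρ η Rw k Cs Cr α X u D U0 P0 b0 →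
      ∃ (𝓚 : (Fin N → ℝ) → (EuclideanSpace ℝ (Fin 3) → EuclideanSpace ℝ (Fin 3)) → EuclideanSpace ℝ (Fin 3) → EuclideanSpace ℝ (Fin 3)) (𝓠 : (Fin N → ℝ) → (EuclideanSpace ℝ (Fin 3) → EuclideanSpace ℝ (Fin 3)) → EuclideanSpace ℝ (Fin 3) → ℝ) (𝓑 : (Fin N → ℝ) → (EuclideanSpace ℝ (Fin 3) → EuclideanSpace ℝ (Fin 3)) → Fin N → ℝ), GateSpec N Γ κ C₂ α D U0 𝓚 𝓠 𝓑

/-- Statement of stub S3 · `NonlinearClosingFrom` (size L; parametrised contraction + admissibility bookkeeping): given the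
gate's `κ, C₂`, the size `Cs` and ANY threshold `k₀`, SOME dressing order `k ≥ k₀` suffices: for every dressed base family
of that order and every gate around it, the fixed point `W_p = 𝓚_p(−r_p − DW_p[W_p])` exists for `Γ ≥ Γ₁` and
`U_p = U⁰_p + W_p`, `P_p = P⁰_p + 𝓠_p(…)`, `B_p = b⁰_p + 𝓑_p(…)` is an admissible reduced family with `C²/C¹` regularity
(`AlmostAdmissibleJ`).  (v4: `∀ k₀` added; the v3 `NonlinearClosing` proof route `k = max(k₀, ⌊2κ⌋ + 1)` is unchanged.) -/
def NonlinearClosingFrom : Prop :=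
  ∀ (N : ℕ) (δ ρ K Λ a b cnd η Rw Rb cg θ₀ : ℝ), 0 < N → 0 < δ → 0 < ρ → 0 ≤ a → 0 < η → 0 < Rw → 0 < Rb → 0 < cg → 0 < θ₀ →
    ∀ Cs κ C₂ : ℝ, ∀ k₀ : ℕ, ∃ k : ℕ, k₀ ≤ k ∧ 1 ≤ k ∧ ∀ Cr : ℝ, ∃ Γ₁ : ℝ, ∀ Γ : ℝ, Γ₁ ≤ Γ → ∀ (γ : (Fin N → ℝ) → Fin N → ℝ) (α : (Fin N → ℝ) → ℝ) (X : (Fin N → ℝ) → Fin N → ℝ → EuclideanSpace ℝ (Fin 3)) (w : (Fin N → ℝ) → Fin N → ℝ → ℝ) (c : (Fin N → ℝ) → Fin N → ℝ) (m : (Fin N → ℝ) → Fin N → EuclideanSpace ℝ (Fin 3)) (n : (Fin N → ℝ) → Fin N → EuclideanSpace ℝ (Fin 3)) (u : (Fin N → ℝ) → (Fin N → ℝ → EuclideanSpace ℝ (Fin 3)) → EuclideanSpace ℝ (Fin 3) → EuclideanSpace ℝ (Fin 3)) (v : (Fin N → ℝ) → EuclideanSpace ℝ (Fin 3) → EuclideanSpace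 ℝ (Fin 3)) (A : (Fin N → ℝ) → Fin N → (EuclideanSpace ℝ (Fin 3) →L[ℝ] EuclideanSpace ℝ (Fin 3))) (T : (Fin N → ℝ) → (Fin N → ℝ → EuclideanSpace ℝ (Fin 3)) → Fin N → ℝ → EuclideanSpace ℝ (Fin 3)) (D : (Fin N → ℝ) → Fin N → EuclideanSpace ℝ (Fin 3) → EuclideanSpace ℝ (Fin 3)),
      DefU N Γ γ u → DefV N α X u v → DefA N X c v A → DefT N α u T → DefD N X c D → BoxClausesJ N Γ δ ρ K Λ a b cnd Rw Rb cg θ₀ γ α X w c m n v A T →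
      ∀ (U0 : (Fin N → ℝ) → EuclideanSpace ℝ (Fin 3) → EuclideanSpace ℝ (Fin 3)) (P0 : (Fin N → ℝ) → EuclideanSpace ℝ (Fin 3) → ℝ) (b0 : (Fin N → ℝ) → Fin N → ℝ), BaseSpec N Γ ρ η Rw k Cs Cr α X u D U0 P0 b0 →
      ∀ (𝓚 : (Fin N → ℝ) → (EuclideanSpace ℝ (Fin 3) → EuclideanSpace ℝ (Fin 3)) → EuclideanSpace ℝ (Fin 3) → EuclideanSpace ℝ (Fin 3)) (𝓠 : (Fin N → ℝ) → (EuclideanSpace ℝ (Fin 3) → EuclideanSpace ℝ (Fin 3)) → EuclideanSpace ℝ (Fin 3) → ℝ) (𝓑 : (Fin N → ℝ) → (EuclideanSpace ℝ (Fin 3) → EuclideanSpace ℝ (Fin 3)) → Fin N → ℝ), GateSpec N Γ κ C₂ α D U0 𝓚 𝓠 𝓑 →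
      ∃ (C₀ M : ℝ) (U : (Fin N → ℝ) → EuclideanSpace ℝ (Fin 3) → EuclideanSpace ℝ (Fin 3)) (P : (Fin N → ℝ) → EuclideanSpace ℝ (Fin 3) → ℝ) (B : (Fin N → ℝ) → Fin N → ℝ), AlmostAdmissibleJ N Γ ρ η Rw α X u D C₀ M U P B

/-- Statement of stub S4 · `EllipticSmoothing` (size M–L; interior regularity for the forced steady profile system): a `C²`
divergence-free velocity with `C¹` pressure solving the profile equation with accretion-mode forcing is `C^∞` (and so is
the pressure).  The accretion modes `D_pj` (defining hypothesis 5, unit tangent by clause 3) are real-analytic fields. -/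
def EllipticSmoothing : Prop :=
  ∀ (N : ℕ) (Γ δ ρ K Λ a b cnd Rw Rb cg θ₀ : ℝ) (γ : (Fin N → ℝ) → Fin N → ℝ) (α : (Fin N → ℝ) → ℝ) (X : (Fin N → ℝ) → Fin N → ℝ → EuclideanSpace ℝ (Fin 3)) (w : (Fin N → ℝ) → Fin N → ℝ → ℝ) (c : (Fin N → ℝ) → Fin N → ℝ) (m : (Fin N → ℝ) → Fin N → EuclideanSpace ℝ (Fin 3)) (n : (Fin N → ℝ) → Fin N → EuclideanSpace ℝ (Fin 3)) (u : (Fin N → ℝ) → (Fin N → ℝ → EuclideanSpace ℝ (Fin 3)) → EuclideanSpace ℝ (Fin 3) → EuclideanSpace ℝ (Fin 3)) (v : (Fin N → ℝ) → EuclideanSpace ℝ (Fin 3) → EuclideanSpace ℝ (Fin 3)) (A : (Fin N → ℝ) → Fin N → (EuclideanSpace ℝ (Fin 3) →L[ℝ] EuclideanSpace ℝ (Fin 3))) (T : (Fin N → ℝ) → (Fin N → ℝ → EuclideanSpace ℝ (Fin 3)) → Fin N → ℝ → EuclideanSpace ℝ (Fin 3)) (D : (Fin N → ℝ) → Fin N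 → EuclideanSpace ℝ (Fin 3) → EuclideanSpace ℝ (Fin 3)),
    DefD N X c D → BoxClausesJ N Γ δ ρ K Λ a b cnd Rw Rb cg θ₀ γ α X w c m n v A T →
    ∀ p : Fin N → ℝ, (∀ i, p i ∈ Icc 0 1) → ∀ (U : EuclideanSpace ℝ (Fin 3) → EuclideanSpace ℝ (Fin 3)) (P : EuclideanSpace ℝ (Fin 3) → ℝ) (B : Fin N → ℝ),
      ContDiff ℝ 2 U → ContDiff ℝ 1 P → VectorCalculus.IsDivFree U →
      (∀ y, α p•(cross (EuclideanSpace.single 2 1) (U y)-fderiv ℝ (U) y (cross (EuclideanSpace.single 2 1) y))+(1/2:ℝ)•U y+(1/2:ℝ)•fderiv ℝ (U) y y-(Laplacian.laplacian (U)) y+fderiv ℝ (U) y (U y)+gradient (P) y = ∑ j, B j•D p j y) →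
      ContDiff ℝ (⊤:ℕ∞) U ∧ ContDiff ℝ (⊤:ℕ∞) P

/-! ## 4. Registered stubs and the kernel-checked composition -/

/-- **Stub S1** (`DressedSkeletonAllOrders`). -/
theorem stub_dressedSkeleton : DressedSkeletonAllOrders := by
  sorry

/-- **Stub S2** (`EventualKelvinGate`; v4 retype of `PolynomialKelvinGate`) — KILL-FIRST. -/
theorem stub_kelvinGate : EventualKelvinGate := by
  sorry

/-- **Stub S3** (`NonlinearClosingFrom`; v4 retype of `NonlinearClosing`). -/
theorem stub_nonlinearClosing : NonlinearClosingFrom := by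
  sorry

/-- **Stub S4** (`EllipticSmoothing`). -/
theorem stub_ellipticSmoothing : EllipticSmoothing := by
  sorry

/-- **Composition (pure logic, no sorry).**  Dressing + gate + closing + smoothing give `TransverseReductionRJ` BY NAME:
constants in the order `Cs` (S1) → `κ, C₂, k₀` (S2) → `k ≥ k₀` (S3) → `Cr` (S1 at `k`) → the three thresholds → `Γ₁ = max`. -/
theorem TransverseReductionRJ_of (h1 : DressedSkeletonAllOrders) (h2 : EventualKelvinGate) (h3 : NonlinearClosingFrom)
    (h4 : EllipticSmoothing) : TransverseReductionRJ := by
  refine transverseReductionRJ_iff.mpr ?_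
  intro N δ ρ K Λ a b cnd η Rw Rb cg θ₀ hN hδ hρ ha hη hRw hRb hcg hθ₀
  obtain ⟨Cs, hS1⟩ := h1 N δ ρ K Λ a b cnd η Rw Rb cg θ₀ hN hδ hρ ha hη hRw hRb hcg hθ₀
  obtain ⟨κ, C₂, k₀, hS2⟩ := h2 N δ ρ K Λ a b cnd η Rw Rb cg θ₀ hN hδ hρ ha hη hRw hRb hcg hθ₀ Cs
  obtain ⟨k, hk₀, hk, hS3⟩ := h3 N δ ρ K Λ a b cnd η Rw Rb cg θ₀ hN hδ hρ ha hη hRw hRb hcg hθ₀ Cs κ C₂ k₀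
  obtain ⟨Cr, Γa, hS1'⟩ := hS1 k
  obtain ⟨Γb, hS2'⟩ := hS2 k hk₀ hk Cr
  obtain ⟨Γc, hS3'⟩ := hS3 Cr
  refine ⟨max Γa (max Γb Γc), ?_⟩
  intro Γ hΓ γ α X w c m n u v A T D hu hv hA hT hD hbox
  have hΓa : Γa ≤ Γ := le_trans (le_max_left _ _) hΓ
  have hΓb : Γb ≤ Γ := le_trans (le_trans (le_max_left _ _) (le_max_right _ _)) hΓ
  have hΓc : Γc ≤ Γ := le_trans (le_trans (le_max_right _ _) (le_max_right _ _)) hΓ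
  obtain ⟨U0, P0, b0, hbase⟩ := hS1' Γ hΓa γ α X w c m n u v A T D hu hv hA hT hD hbox
  obtain ⟨𝓚, 𝓠, 𝓑, hgate⟩ := hS2' Γ hΓb γ α X w c m n u v A T D hu hv hA hT hD hbox U0 P0 b0 hbase
  obtain ⟨C₀, M, U, P, B, hB, hU⟩ := hS3' Γ hΓc γ α X w c m n u v A T D hu hv hA hT hD hbox U0 P0 b0 hbase 𝓚 𝓠 𝓑 hgate
  refine ⟨C₀, M, U, P, B, hB, fun p hp => ?_⟩
  obtain ⟨hne, hU2, hP1, hdiv, heq, hdec, hPM, hwin⟩ := hU p hp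
  obtain ⟨hUs, hPs⟩ := h4 N Γ δ ρ K Λ a b cnd Rw Rb cg θ₀ γ α X w c m n u v A T D hD hbox p hp (U p) (P p) (B p) hU2 hP1 hdiv heq
  exact ⟨hne, hUs, hPs, hdiv, heq, hdec, hPM, hwin⟩

/-- The crux from the registered stubs (so the audit shows exactly which sorries the line rests on). -/
theorem transverseReductionRJ_from_line : TransverseReductionRJ :=
  TransverseReductionRJ_of stub_dressedSkeleton stub_kelvinGate stub_nonlinearClosing stub_ellipticSmoothing


end Summit.NavierStokesRegularity.NavierStokesRegularity.Cruxes.TransverseReductionRJ.KelvinGate
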